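import Mathlib.FieldTheory.Galois.Infinite
import Mathlib.FieldTheory.IsAlgClosed.AlgebraicClosure
import Mathlib.RingTheory.RootsOfUnity.Basic
import Mathlib.RingTheory.Valuation.Integers
import Mathlib.Algebra.GroupWithZero.Units.Fintype
import Mathlib.NumberTheory.LocalField.Basic
import Mathlib.RingTheory.Ideal.Quotient.Index
import Mathlib.RingTheory.Filtration
import HarnessLib

/-!
# Galois-equivariant, valuation-preserving endomorphisms of `L̄ˣ` fix the base field (Kummer rigidity)

Classical local algebra, PROOF-ONLY over Mathlib (no cell interface imported, no definition, no named
fact). Sources: J. Neukirch, *Algebraic Number Theory*, Ch. II Prop. (5.7) (structure of `Kˣ` for a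
`p`-adic field: `Kˣ ≅ ℤ ⊕ ℤ/(q−1) ⊕ ℤ/pᵃ ⊕ ℤ_pᵈ`, whence `⋂ₙ (Kˣ)ⁿ = 1`) [cite: NeukirchANT1999,
Ch. II Prop. 5.7]; J.-P. Serre, *Local Fields*, Ch. II §3 (units of the valuation ring)
[cite: SerreLocalFields1979, Ch. II §3]; the Kummer cocycle computation is folklore (Kummer theory
without Hilbert 90: only the cyclicity of `μₙ` and the fixed field of `Aut(L/K)` are used).

## Statements

* `exists_int_forall_pow_eq_one_map_eq_zpow` — a multiplicative map `C : L →*₀ L` of a field acts on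
  `μₙ(L)` by ONE integer power `ζ ↦ ζ^m` (`μₙ(L)` is cyclic).
* `kummer_cocycle_map_div` — for `xⁿ = b ∈ K`, `σ ∈ Aut(L/K)`, and `C` commuting with `Aut(L/K)`:
  `σ (C x / x) = (σ x / x)^{m−1} · (C x / x)`.
* `exists_map_algebraMap_eq_pow_mul` — **algebraic core**: `L/K` Galois (any degree; fixed field of
  `Aut(L/K)` is `K`, Mathlib `InfiniteGalois.mem_range_algebraMap_iff_fixed`), `v : Valuation L Γ₀`
  DISCRETE ON `K` with uniformiser `π` (`v π < 1` and `v(Kˣ) ⊆ (v π)^ℤ`), `C : L →*₀ L` multiplicative,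
  `Aut(L/K)`-EQUIVARIANT and `v`-PRESERVING, `L ∋` `n`-th roots of `π` and of `a ∈ K`
  ⟹ `C a = wⁿ · a` for some `w ∈ K`.
* `exists_valuation_eq_zpow_of_ne_zero`, `valuation_eq_one_of_forall_exists_pow_eq`,
  `eq_one_of_forall_exists_pow_eq` — for a NON-ARCHIMEDEAN LOCAL FIELD `K` (Mathlib
  `IsNonarchimedeanLocalField`): a valuative uniformiser exists; an element with `n`-th roots for all
  `n` has valuation `1`; and **`⋂ₙ (Kˣ)ⁿ = {1}`** (finite `𝒪/𝓂^r`, Mathlib `Ideal.finite_quotient_pow`,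
  plus Krull `Ideal.iInf_pow_eq_bot_of_isLocalRing`).
* `map_algebraMap_eq_self_of_uniformiser` / `_of_isEquiv` / `_of_isAlgClosure` — **Kummer rigidity**:
  over a non-archimedean local field `K`, every `Aut(L/K)`-equivariant `v`-preserving multiplicative
  `C : L →*₀ L` (`L/K` Galois with enough roots, resp. `L` an algebraic closure of `K` in
  characteristic `0`; `v|_K` discrete, resp. equivalent to the valuation of `K`) FIXES `K` POINTWISE —
  in particular `C p = p` and `C` fixes every uniformiser.

## Why (cell context; nothing here takes a side on any disputed claim)

Written for the abc-iut cell (seat abc-iut-w4-d014 gen 8; L5-lead RULINGS #80 (1), 2026-08-26) as the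
residual «(E3)» isolated by abc-iut-L5-t16 (HOME/staging/L5/L5-t16/g6/STEP0-E33iii-e.md) for
[IUTchI] Example 3.3 (iii), clause (e) `SplitFromF` at the genuine datum: after the Frobenioid-side
transport (E1) and the anabelian input (E2) one is left with a `Gal(k̄/k)`-equivariant,
valuation-preserving automorphism `C = σ⁻¹ ∘ β` of `k̄ˣ` and must show `C(p) = p`; this file proves
`C|_{kˣ} = id` for every such ENDOmorphism. An endomorphism of the group `Lˣ` extended by `0 ↦ 0` is
exactly a `MonoidWithZeroHom L L`, which is the form used here (`map_ne_zero`). Deliberately NOT here: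
the identification of `v` with the unique extension of the `p`-adic valuation (the consumer supplies
`Valuation.IsEquiv` on `K`, or a uniformiser directly), and any statement about [IUTchIII].
-/
namespace Literature.NumberTheory.LocalFields

section Kummer

variable {K L : Type*} [Field K] [Field L] [Algebra K L]

/-- A multiplicative map `C : L →*₀ L` of a field acts on the `n`-th roots of unity of `L` by a
single integer power `ζ ↦ ζ ^ m` (the group `μₙ(L)` is cyclic, Mathlib `rootsOfUnity.isCyclic`; the
standing set-up of Kummer theory). [cite: NeukirchANT1999, Ch. IV §3] -/
theorem exists_int_forall_pow_eq_one_map_eq_zpow (C : L →*₀ L) (n : ℕ) [NeZero n] :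
    ∃ m : ℤ, ∀ ζ : L, ζ ^ n = 1 → C ζ = ζ ^ m := by
  obtain ⟨g, hg⟩ := IsCyclic.exists_generator (α := rootsOfUnity n L)
  have hg1 : ((g : Lˣ) : L) ^ n = 1 := by
    have h := g.2
    rw [mem_rootsOfUnity] at h
    have := congrArg Units.val h
    simpa [Units.val_pow_eq_pow_val] using this
  have hC0 : C ((g : Lˣ) : L) ≠ 0 := (map_ne_zero C).mpr (Units.ne_zero _)
  have hCn : (C ((g : Lˣ) : L)) ^ n = 1 := by rw [← map_pow, hg1, map_one]
  have humem : Units.mk0 _ hC0 ∈ rootsOfUnity n L := by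
    rw [mem_rootsOfUnity]; ext; simp [Units.val_pow_eq_pow_val, hCn]
  obtain ⟨m, hm⟩ := hg ⟨_, humem⟩
  refine ⟨m, fun ζ hζ => ?_⟩
  have hζ0 : ζ ≠ 0 := by
    rintro rfl
    simp [zero_pow (NeZero.ne n)] at hζ
  have hζmem : Units.mk0 ζ hζ0 ∈ rootsOfUnity n L := by
    rw [mem_rootsOfUnity]; ext; simp [Units.val_pow_eq_pow_val, hζ]
  obtain ⟨i, hi⟩ := hg ⟨_, hζmem⟩
  have hζeq : ζ = ((g : Lˣ) : L) ^ i := by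
    have := congrArg (fun x : rootsOfUnity n L => ((x : Lˣ) : L)) hi
    simpa [Units.val_zpow_eq_zpow_val] using this.symm
  have hCg : C ((g : Lˣ) : L) = ((g : Lˣ) : L) ^ m := by
    have := congrArg (fun x : rootsOfUnity n L => ((x : Lˣ) : L)) hm
    simpa [Units.val_zpow_eq_zpow_val] using this.symm
  rw [hζeq, map_zpow₀, hCg, ← zpow_mul, ← zpow_mul, mul_comm]

variable {Γ₀ : Type*} [LinearOrderedCommGroupWithZero Γ₀]

/-- **Kummer computation.** For a multiplicative `C : L →*₀ L` commuting with `Aut(L/K)`, an element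
`x ≠ 0` of `L` with `x ^ n ∈ K`, and `σ ∈ Aut(L/K)`: the Kummer cocycle `ζ_σ := σ x / x` is an `n`-th root
of unity, and `w := C x / x` satisfies `σ w = ζ_σ ^ (m - 1) · w`, where `m` is the exponent by which `C`
acts on `μₙ(L)` (the Kummer character `χ_b(σ) = σx/x` of Neukirch IV §3). [cite: NeukirchANT1999, Ch. IV §3] -/
theorem kummer_cocycle_map_div (C : L →*₀ L) (hC : ∀ (σ : L ≃ₐ[K] L) (x : L), C (σ x) = σ (C x))
    {n : ℕ} {m : ℤ} (hm : ∀ ζ : L, ζ ^ n = 1 → C ζ = ζ ^ m)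
    {b : K} {x : L} (hx0 : x ≠ 0) (hxn : x ^ n = algebraMap K L b) (σ : L ≃ₐ[K] L) :
    (σ x / x) ^ n = 1 ∧ σ x / x ≠ 0 ∧ σ (C x / x) = (σ x / x) ^ (m - 1) * (C x / x) := by
  have hσx0 : σ x ≠ 0 := by
    intro h
    exact hx0 (by simpa using congrArg σ.symm h)
  have hb0 : algebraMap K L b ≠ 0 := hxn ▸ pow_ne_zero n hx0
  have hζn : (σ x / x) ^ n = 1 := by
    rw [div_pow, ← map_pow, hxn, AlgEquiv.commutes, div_self hb0]
  have hζ0 : σ x / x ≠ 0 := div_ne_zero hσx0 hx0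
  refine ⟨hζn, hζ0, ?_⟩
  have hσx : σ x = (σ x / x) * x := by rw [div_mul_cancel₀ _ hx0]
  have h1 : σ (C x) = (σ x / x) ^ m * C x := by
    rw [← hC, hσx, map_mul, hm _ hζn, div_mul_cancel₀ _ hx0]
  rw [map_div₀, h1, zpow_sub_one₀ hζ0]
  field_simp

/-- **Kummer rigidity — algebraic core.** Let `L/K` be a Galois extension (possibly infinite: the
fixed field of `Aut(L/K)` is `K`, Mathlib `InfiniteGalois.mem_range_algebraMap_iff_fixed`), `v` a
valuation on `L` whose values on `Kˣ` are the integer powers of `v π` for some `π ∈ Kˣ` with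
`v π < 1` (i.e. `v|_K` is discrete with uniformiser `π`), and `C : L →*₀ L` a multiplicative map that
COMMUTES with every `σ ∈ Aut(L/K)` and PRESERVES `v`. If `L` contains `n`-th roots of `π` and of
`a ∈ K`, then `C a = wⁿ · a` for some `w ∈ K`. Proof (Kummer theory, no class field theory): `C` acts on
`μₙ(L)` by `ζ ↦ ζ^m`; for `xⁿ = a` the element `c := (C x / x) · x^{1−m}` is `Aut(L/K)`-fixed, so lies in
`K`, and `v c = (v x)^{1−m}`; at `a = π` discreteness forces `n ∣ 1 − m`, whence `C x / x` itself is fixed,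
`C x / x = w ∈ K` and `C a / a = wⁿ`. [cite: NeukirchANT1999, Ch. IV §3] -/
theorem exists_map_algebraMap_eq_pow_mul [IsGalois K L] (v : Valuation L Γ₀)
    (C : L →*₀ L) (hC : ∀ (σ : L ≃ₐ[K] L) (x : L), C (σ x) = σ (C x))
    (hv : ∀ x : L, v (C x) = v x)
    {n : ℕ} [NeZero n] {π : K} (hπ0 : π ≠ 0) (hπ1 : v (algebraMap K L π) < 1)
    (hdisc : ∀ c : K, c ≠ 0 → ∃ k : ℤ, v (algebraMap K L c) = v (algebraMap K L π) ^ k)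
    (hπroot : ∃ y : L, y ^ n = algebraMap K L π)
    {a : K} (haroot : ∃ x : L, x ^ n = algebraMap K L a) :
    ∃ w : K, C (algebraMap K L a) = algebraMap K L (w ^ n * a) := by
  obtain ⟨m, hm⟩ := exists_int_forall_pow_eq_one_map_eq_zpow C n
  -- the `Aut(L/K)`-fixed element attached to an `n`-th root `x` of an element of `K`
  have hfixed : ∀ (b : K) (x : L), x ≠ 0 → x ^ n = algebraMap K L b →
      ∃ c : K, algebraMap K L c = (C x / x) * x ^ (1 - m) := by
    intro b x hx0 hxn
    rw [← Set.mem_range, InfiniteGalois.mem_range_algebraMap_iff_fixed]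
    intro σ
    obtain ⟨-, hζ0, hσw⟩ := kummer_cocycle_map_div C hC hm hx0 hxn σ
    have hσx : σ x = (σ x / x) * x := by rw [div_mul_cancel₀ _ hx0]
    rw [map_mul, map_zpow₀, hσw, hσx, mul_zpow, div_mul_cancel₀ _ hx0]
    have h1 : (σ x / x) ^ (m - 1) * (σ x / x) ^ (1 - m) = 1 := by
      rw [← zpow_add₀ hζ0, show m - 1 + (1 - m) = 0 by ring, zpow_zero]
    calc (σ x / x) ^ (m - 1) * (C x / x) * ((σ x / x) ^ (1 - m) * x ^ (1 - m))
        = ((σ x / x) ^ (m - 1) * (σ x / x) ^ (1 - m)) * ((C x / x) * x ^ (1 - m)) := by ring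
      _ = C x / x * x ^ (1 - m) := by rw [h1, one_mul]
  -- at the uniformiser: `n ∣ 1 - m`
  have hπ0' : algebraMap K L π ≠ 0 := by simpa using hπ0
  obtain ⟨y, hyn⟩ := hπroot
  have hy0 : y ≠ 0 := fun h => hπ0' (by rw [← hyn, h, zero_pow (NeZero.ne n)])
  obtain ⟨c, hc⟩ := hfixed π y hy0 hyn
  have hCy0 : C y ≠ 0 := (map_ne_zero C).mpr hy0
  have hvw : v (C y / y) = 1 := by rw [map_div₀, hv, div_self ((map_ne_zero v).mpr hy0)]
  have hvc : v (algebraMap K L c) = v y ^ (1 - m) := by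
    rw [hc, map_mul, hvw, one_mul, map_zpow₀]
  have hc0 : c ≠ 0 := by
    intro h
    rw [h, map_zero] at hc
    exact mul_ne_zero (div_ne_zero hCy0 hy0) (zpow_ne_zero _ hy0) hc.symm
  obtain ⟨k, hk⟩ := hdisc c hc0
  have hg : v y ^ n = v (algebraMap K L π) := by rw [← map_pow, hyn]
  have hg0 : v (algebraMap K L π) ≠ 0 := (map_ne_zero v).mpr hπ0'
  have hkey : v (algebraMap K L π) ^ (k * n) = v (algebraMap K L π) ^ (1 - m) := by
    rw [zpow_mul, ← hk, hvc, ← hg, ← zpow_natCast (v y) n, ← zpow_mul, ← zpow_mul, mul_comm]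
  have hkn : k * n = 1 - m := zpow_right_injective₀ (zero_lt_iff.mpr hg0) hπ1.ne hkey
  have hm1 : m - 1 = -((n : ℤ) * k) := by linear_combination hkn
  -- the element `a`
  by_cases ha : a = 0
  · exact ⟨1, by simp [ha]⟩
  obtain ⟨x, hxn⟩ := haroot
  have ha' : algebraMap K L a ≠ 0 := by simpa using ha
  have hx0 : x ≠ 0 := fun h => ha' (by rw [← hxn, h, zero_pow (NeZero.ne n)])
  have hwfix : ∀ σ : L ≃ₐ[K] L, σ (C x / x) = C x / x := by
    intro σ
    obtain ⟨hζn, -, hσw⟩ := kummer_cocycle_map_div C hC hm hx0 hxn σ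
    rw [hσw, hm1, zpow_neg, zpow_mul, zpow_natCast, hζn, one_zpow, inv_one, one_mul]
  obtain ⟨w, hw⟩ := (InfiniteGalois.mem_range_algebraMap_iff_fixed (C x / x)).mpr hwfix
  refine ⟨w, ?_⟩
  rw [map_mul, map_pow, hw, ← hxn, map_pow, div_pow, div_mul_cancel₀ _ (pow_ne_zero n hx0)]

end Kummer

section LocalField

open ValuativeRel

variable {K : Type*} [Field K] [ValuativeRel K] [TopologicalSpace K] [IsNonarchimedeanLocalField K]

/-- A non-archimedean local field has a UNIFORMISER in the valuative sense: an element `ϖ` with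
`v ϖ < 1` such that every non-zero value `v x` is an integer power of `v ϖ` (the value group is
infinite cyclic, Mathlib's `IsCyclic (ValueGroupWithZero K)ˣ` instance for local fields).
[cite: NeukirchANT1999, Ch. II Prop. 5.7] -/
theorem exists_valuation_eq_zpow_of_ne_zero :
    ∃ ϖ : K, ϖ ≠ 0 ∧ valuation K ϖ < 1 ∧
      ∀ x : K, x ≠ 0 → ∃ k : ℤ, valuation K x = valuation K ϖ ^ k := by
  obtain ⟨g, hg⟩ := IsCyclic.exists_generator (α := (ValueGroupWithZero K)ˣ)
  -- a generator below `1`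
  obtain ⟨g', hg'1, hg'⟩ : ∃ g' : (ValueGroupWithZero K)ˣ,
      (g' : ValueGroupWithZero K) < 1 ∧ ∀ x, x ∈ Subgroup.zpowers g' := by
    rcases lt_trichotomy (g : ValueGroupWithZero K) 1 with h | h | h
    · exact ⟨g, h, hg⟩
    · exfalso
      obtain ⟨γ, hγ0, hγ1⟩ := IsNontrivial.exists_lt_one (R := K)
      obtain ⟨k, hk⟩ := Subgroup.mem_zpowers_iff.mp (hg (Units.mk0 γ hγ0.ne'))
      have hg1 : g = 1 := Units.val_eq_one.mp h
      rw [hg1, one_zpow] at hk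
      have : γ = 1 := by
        have := congrArg Units.val hk
        simpa using this.symm
      exact hγ1.ne this
    · refine ⟨g⁻¹, ?_, by rw [Subgroup.zpowers_inv]; exact hg⟩
      rw [Units.val_inv_eq_inv_val]
      exact inv_lt_one_of_one_lt₀ h
  obtain ⟨ϖ, hϖ⟩ := ValuativeRel.valuation_surjective (g' : ValueGroupWithZero K)
  have hϖ0 : ϖ ≠ 0 := by
    intro h
    rw [h, map_zero] at hϖ
    exact g'.ne_zero hϖ.symm
  refine ⟨ϖ, hϖ0, hϖ ▸ hg'1, fun x hx => ?_⟩
  obtain ⟨k, hk⟩ := Subgroup.mem_zpowers_iff.mp (hg' (Units.mk0 _ ((map_ne_zero (valuation K)).mpr hx)))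
  refine ⟨k, ?_⟩
  have := congrArg Units.val hk
  simp only [Units.val_zpow_eq_zpow_val, Units.val_mk0] at this
  rw [← this, hϖ]

/-- In a non-archimedean local field, an element admitting `n`-th roots for every `n ≥ 1` has
valuation `1` (the value group is `ℤ`: `v u = n · v w` for all `n` forces `v u = 0` additively).
[cite: NeukirchANT1999, Ch. II Prop. 5.7] -/
theorem valuation_eq_one_of_forall_exists_pow_eq {u : K} (hu : u ≠ 0)
    (h : ∀ n : ℕ, 0 < n → ∃ w : K, w ^ n = u) : valuation K u = 1 := by
  obtain ⟨ϖ, hϖ0, hϖ1, hU⟩ := exists_valuation_eq_zpow_of_ne_zero (K := K)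
  have hvϖ0 : valuation K ϖ ≠ 0 := (map_ne_zero _).mpr hϖ0
  obtain ⟨z, hz⟩ := hU u hu
  obtain ⟨w, hw⟩ := h (z.natAbs + 1) (Nat.succ_pos _)
  have hw0 : w ≠ 0 := by
    rintro rfl
    rw [zero_pow (Nat.succ_ne_zero _)] at hw
    exact hu hw.symm
  obtain ⟨zw, hzw⟩ := hU w hw0
  have key : valuation K ϖ ^ z = valuation K ϖ ^ (zw * (z.natAbs + 1 : ℕ)) := by
    rw [← hz, ← hw, map_pow, hzw, ← zpow_natCast, ← zpow_mul]
  have hzz : z = zw * (z.natAbs + 1 : ℕ) :=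
    zpow_right_injective₀ (zero_lt_iff.mpr hvϖ0) hϖ1.ne key
  have hz0 : z = 0 := by
    rcases eq_or_ne zw 0 with h0 | h0
    · simpa [h0] using hzz
    · exfalso
      have habs := congrArg Int.natAbs hzz
      rw [Int.natAbs_mul, Int.natAbs_natCast] at habs
      have h1 : 0 < zw.natAbs := Int.natAbs_pos.mpr h0
      have h2 : z.natAbs + 1 ≤ zw.natAbs * (z.natAbs + 1) := Nat.le_mul_of_pos_left _ h1
      omega
  rw [hz, hz0, zpow_zero]

omit [TopologicalSpace K] [IsNonarchimedeanLocalField K] in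
/-- An element `w` of `K` of valuation `1`, viewed as an element `⟨w, _⟩` of the valuation ring `𝒪[K]`,
is a unit there (Mathlib `Valuation.Integers.isUnit_of_one'`). [cite: SerreLocalFields1979, Ch. II §3] -/
theorem isUnit_integer_of_valuation_eq_one {w : K} (hw : valuation K w = 1) :
    IsUnit (⟨w, (Valuation.mem_integer_iff _ _).mpr hw.le⟩ : 𝒪[K]) :=
  Valuation.Integers.isUnit_of_one' (Valuation.integer.integers (valuation K)) (by exact hw)

/-- **`⋂ₙ (Kˣ)ⁿ = {1}` in a non-archimedean local field.** If `u ≠ 0` is an `n`-th power in `K`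
for every `n ≥ 1`, then `u = 1`. Proof: `v u = 1` by discreteness of the value group; then for every
`r`, with `N := #(𝒪/𝓂^r)ˣ` (finite: Mathlib `Ideal.finite_quotient_pow` from the finite residue field)
and `u = w^N`, `w` is a unit of `𝒪` and `w^N ≡ 1 (mod 𝓂^r)`, so `u − 1 ∈ ⋂ᵣ 𝓂^r = 0` (Krull, Mathlib
`Ideal.iInf_pow_eq_bot_of_isLocalRing`). [cite: NeukirchANT1999, Ch. II Prop. 5.7] -/
theorem eq_one_of_forall_exists_pow_eq {u : K} (hu : u ≠ 0)
    (h : ∀ n : ℕ, 0 < n → ∃ w : K, w ^ n = u) : u = 1 := by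
  have hvu : valuation K u = 1 := valuation_eq_one_of_forall_exists_pow_eq hu h
  set U : 𝒪[K] := ⟨u, (Valuation.mem_integer_iff _ _).mpr hvu.le⟩ with hUdef
  -- `U - 1 ∈ 𝓂^r` for every `r`
  have hmem : ∀ r : ℕ, U - 1 ∈ 𝓂[K] ^ r := by
    intro r
    haveI : Finite (𝒪[K] ⧸ 𝓂[K]) := inferInstanceAs (Finite 𝓀[K])
    haveI : Finite (𝒪[K] ⧸ 𝓂[K] ^ r) :=
      Ideal.finite_quotient_pow (IsNoetherian.noetherian _) r
    set N := Nat.card (𝒪[K] ⧸ 𝓂[K] ^ r)ˣ with hN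
    have hNpos : 0 < N := Nat.card_pos
    obtain ⟨w, hw⟩ := h N hNpos
    have hw0 : w ≠ 0 := by
      rintro rfl
      rw [zero_pow hNpos.ne'] at hw
      exact hu hw.symm
    have hvw : valuation K w = 1 := by
      have hpow : valuation K w ^ N = 1 := by rw [← map_pow, hw, hvu]
      rcases lt_trichotomy (valuation K w) 1 with hlt | heq | hgt
      · exact absurd hpow (pow_lt_one₀ zero_le hlt hNpos.ne').ne
      · exact heq
      · exact absurd hpow (one_lt_pow₀ hgt hNpos.ne').ne'
    set W : 𝒪[K] := ⟨w, (Valuation.mem_integer_iff _ _).mpr hvw.le⟩ with hWdef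
    have hWU : W ^ N = U := Subtype.ext (by simp [W, U, hw])
    obtain ⟨Wq, hWq⟩ := (isUnit_integer_of_valuation_eq_one hvw).map (Ideal.Quotient.mk (𝓂[K] ^ r))
    have hq : Ideal.Quotient.mk (𝓂[K] ^ r) (W ^ N) = Ideal.Quotient.mk (𝓂[K] ^ r) 1 := by
      rw [map_pow, map_one, ← hWq, ← Units.val_pow_eq_pow_val, hN, pow_card_eq_one', Units.val_one]
    rw [← hWU]
    exact Ideal.Quotient.eq.mp hq
  have hbot : (⨅ r : ℕ, 𝓂[K] ^ r) = ⊥ :=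
    Ideal.iInf_pow_eq_bot_of_isLocalRing _ (IsLocalRing.maximalIdeal.isMaximal 𝒪[K]).ne_top
  have hU1 : U - 1 ∈ (⨅ r : ℕ, 𝓂[K] ^ r) := Ideal.mem_iInf.mpr hmem
  rw [hbot, Ideal.mem_bot, sub_eq_zero] at hU1
  have := congrArg Subtype.val hU1
  simpa [U] using this

end LocalField

section Assembly

open ValuativeRel

variable {K L : Type*} [Field K] [ValuativeRel K] [TopologicalSpace K] [IsNonarchimedeanLocalField K]
variable [Field L] [Algebra K L] [IsGalois K L]
variable {Γ₀ : Type*} [LinearOrderedCommGroupWithZero Γ₀]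

/-- **Kummer rigidity over a non-archimedean local field (explicit-uniformiser form).** `K` a
non-archimedean local field, `L/K` Galois, `v` a valuation on `L` which is discrete on `K` with
uniformiser `π` (`v π < 1`, every value of `Kˣ` an integer power of `v π`), and `L` containing `n`-th
roots of all elements of `K` for all `n ≥ 1`. Then every multiplicative `C : L →*₀ L` commuting with
`Aut(L/K)` and preserving `v` FIXES `K` POINTWISE: by the algebraic core (Kummer theory, Neukirch IV §3)
`C a / a ∈ (Kˣ)ⁿ` for all `n`, and `⋂ₙ (Kˣ)ⁿ = {1}` (Neukirch II (5.7)). [cite: NeukirchANT1999, Ch. II Prop. 5.7] -/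
theorem map_algebraMap_eq_self_of_uniformiser (v : Valuation L Γ₀)
    (C : L →*₀ L) (hC : ∀ (σ : L ≃ₐ[K] L) (x : L), C (σ x) = σ (C x))
    (hv : ∀ x : L, v (C x) = v x)
    {π : K} (hπ0 : π ≠ 0) (hπ1 : v (algebraMap K L π) < 1)
    (hdisc : ∀ c : K, c ≠ 0 → ∃ k : ℤ, v (algebraMap K L c) = v (algebraMap K L π) ^ k)
    (hroots : ∀ n : ℕ, 0 < n → ∀ a : K, ∃ x : L, x ^ n = algebraMap K L a)
    (a : K) : C (algebraMap K L a) = algebraMap K L a := by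
  by_cases ha : a = 0
  · simp [ha]
  have main : ∀ n : ℕ, 0 < n → ∃ w : K, C (algebraMap K L a) = algebraMap K L (w ^ n * a) := by
    intro n hn
    haveI : NeZero n := ⟨hn.ne'⟩
    exact exists_map_algebraMap_eq_pow_mul v C hC hv hπ0 hπ1 hdisc (hroots n hn π) (hroots n hn a)
  obtain ⟨u, hu⟩ := main 1 one_pos
  rw [pow_one] at hu
  have ha' : algebraMap K L a ≠ 0 := by simpa using ha
  have hu0 : u ≠ 0 := by
    intro h
    rw [h, zero_mul, map_zero] at hu
    exact (map_ne_zero C).mpr ha' hu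
  have hun : ∀ n : ℕ, 0 < n → ∃ w : K, w ^ n = u := by
    intro n hn
    obtain ⟨w, hw⟩ := main n hn
    refine ⟨w, mul_right_cancel₀ ha ((algebraMap K L).injective ?_)⟩
    rw [← hw, hu]
  rw [hu, eq_one_of_forall_exists_pow_eq hu0 hun, one_mul]

/-- **Kummer rigidity over a non-archimedean local field (equivalent-valuation form).** As
`map_algebraMap_eq_self_of_uniformiser`, with the discreteness hypothesis replaced by: the restriction
of `v` to `K` is EQUIVALENT (Mathlib `Valuation.IsEquiv`) to the canonical valuation of the local field
`K` — e.g. `v` the unique extension of the valuation of `K` to an algebraic `L`.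
[cite: NeukirchANT1999, Ch. II Prop. 5.7] -/
theorem map_algebraMap_eq_self_of_isEquiv (v : Valuation L Γ₀)
    (hcompat : (v.comap (algebraMap K L)).IsEquiv (valuation K))
    (C : L →*₀ L) (hC : ∀ (σ : L ≃ₐ[K] L) (x : L), C (σ x) = σ (C x))
    (hv : ∀ x : L, v (C x) = v x)
    (hroots : ∀ n : ℕ, 0 < n → ∀ a : K, ∃ x : L, x ^ n = algebraMap K L a)
    (a : K) : C (algebraMap K L a) = algebraMap K L a := by
  obtain ⟨ϖ, hϖ0, hϖ1, hU⟩ := exists_valuation_eq_zpow_of_ne_zero (K := K)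
  have hle : ∀ c d : K, v (algebraMap K L c) ≤ v (algebraMap K L d) ↔
      valuation K c ≤ valuation K d := fun c d => hcompat c d
  have heq : ∀ c d : K, valuation K c = valuation K d →
      v (algebraMap K L c) = v (algebraMap K L d) := fun c d h =>
    le_antisymm ((hle c d).mpr h.le) ((hle d c).mpr h.ge)
  have hπ1 : v (algebraMap K L ϖ) < 1 := by
    have h1 : ¬ valuation K 1 ≤ valuation K ϖ := by simpa using hϖ1
    rw [← hle, map_one, map_one] at h1
    exact not_le.mp h1
  refine map_algebraMap_eq_self_of_uniformiser v C hC hv hϖ0 hπ1 (fun c hc => ?_) hroots a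
  obtain ⟨k, hk⟩ := hU c hc
  refine ⟨k, ?_⟩
  rw [← map_zpow₀, ← map_zpow₀]
  exact heq _ _ (by rw [map_zpow₀, hk])

omit [IsGalois K L] in
/-- **Kummer rigidity for the algebraic closure of a `p`-adic field.** `K` a non-archimedean local
field of characteristic `0`, `L` an algebraic closure of `K` (so `L/K` is Galois, Mathlib
`IsAlgClosure.isGalois`, and every element of `K` has `n`-th roots in `L`), `v` a valuation on `L`
equivalent on `K` to the canonical one. Then every `Gal(L/K)`-EQUIVARIANT, `v`-PRESERVING
multiplicative map `C : L →*₀ L` (equivalently: equivariant valuation-preserving endomorphism of the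
group `Lˣ`, extended by `C 0 = 0`) fixes `K` pointwise — in particular `C p = p` and `C` fixes every
uniformiser of `K`. [cite: NeukirchANT1999, Ch. II Prop. 5.7] -/
theorem map_algebraMap_eq_self_of_isAlgClosure [CharZero K] [IsAlgClosure K L] (v : Valuation L Γ₀)
    (hcompat : (v.comap (algebraMap K L)).IsEquiv (valuation K))
    (C : L →*₀ L) (hC : ∀ (σ : L ≃ₐ[K] L) (x : L), C (σ x) = σ (C x))
    (hv : ∀ x : L, v (C x) = v x) (a : K) :
    C (algebraMap K L a) = algebraMap K L a := by
  haveI : IsAlgClosed L := IsAlgClosure.isAlgClosed K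
  exact map_algebraMap_eq_self_of_isEquiv v hcompat C hC hv
    (fun n hn b => IsAlgClosed.exists_pow_nat_eq _ hn) a

end Assembly

end Literature.NumberTheory.LocalFields
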